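import Summits.ABC.ABC.Theses.PadicPrincipalCoreST86
import HarnessLib

/-!
# Route PadicPrincipalCoreST86, item `Assembly` (stmt-ABC-18955): the deciding composition

`Summits/ABC/ABC/Theorems/PadicPrincipalCoreST86Assembly.lean` — cell `abc-stewartyu`, seat p3.
`TheoremA → WPM → GlueSpec → OddShapeSpec → stewartTijdeman1986_upperBound`: the route file's own
`closes` theorem, restated as the item.
-/

set_option linter.dupNamespace false

namespace Summit.ABC.ABC.Theorems

/-- **Item `Assembly` of route PadicPrincipalCoreST86.** [folklore] -/
theorem padicPrincipalCoreST86_assembly_proof : Summit.ABC.ABC.Theses.PadicPrincipalCoreST86.Assembly :=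
  fun hA hM hG hO => Summit.ABC.ABC.Theses.PadicPrincipalCoreST86.closes hA hM hG hO

end Summit.ABC.ABC.Theorems
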